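import Literature.MathematicalPhysics.StatisticalMechanics.PeriodicRieszKernelFourier
import Mathlib.MeasureTheory.Integral.Prod
import HarnessLib

/-!
# The periodic Riesz kernel: zero cell mean

For the smeared, zero-mean, `Lℤ³`-periodic Riesz-`s` kernel
`g = Literature.MathematicalPhysics.StatisticalMechanics.periodicRieszKernel s L η`
(`PeriodicRieszKernel.lean`, `PeriodicRieszKernelFourier.lean`) we prove that the subtracted
constant `L⁻³` is exactly the cell average of the periodised heat kernel, so that

* `∫_{[0,L)³} Σ_{m ∈ ℤ³} G_t(x - Lm) dx = ∫_{ℝ³} G_t = 1` (`integral_cell_tsum_heatKernel`; tiling of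
  `ℝ³` by the translates of the cell, `BoseGas.tsum_lintegral_cell_sub_latticeVec`, and unit mass
  of the Gauss kernel, `integral_heatKernel_eq_one_holds`),
* `∫_{[0,L)³} Θ_{L,t}(x) dx = 0` (`integral_cell_periodicHeatSum`), and
* **`∫_{[0,L)³} g(x) dx = 0`**, i.e. `ĝ(0) = 0` (`integral_cell_periodicRieszKernel`; Fubini over
  `[0,L)³ × (η², ∞)`, justified by the uniform exponential bound
  `|t^a Θ_{L,t}(x)| ≤ D t^a e^{-4π²t/L²}`).

This is the neutrality ("zero Fourier mode") of the kernel used in route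
`AtomisticToContinuum/BECRieszShadow` (Lewin 2022; Serfaty 2024, Ch. 3–4: background-subtracted
periodic Riesz interaction). Everything is proved; no named fact is introduced.
-/

noncomputable section

namespace Literature.MathematicalPhysics.StatisticalMechanics

open MeasureTheory Set Filter Real Function
open scoped _root_.Topology ENNReal
open Literature.Analysis.UnboundedOperators Literature.Analysis.FunctionSpaces
open Literature.MathematicalPhysics.QuantumManyBody.BoseGas

/-! ## The cell average of the periodised heat kernel -/

/-- **Tiling identity for the heat kernel**: `∫⁻_{[0,L)³} Σ_{m ∈ ℤ³} G_t(x - Lm) dx = 1`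
(`L, t > 0`; the translates of the cell tile `ℝ³` and `∫ G_t = 1`). [folklore] -/
theorem lintegral_cell_tsum_heatKernel {L t : ℝ} (hL : 0 < L) (ht : 0 < t) :
    ∫⁻ x in cell L, ENNReal.ofReal (∑' m : Fin 3 → ℤ, heatKernel t (x - latticeVec L m)) = 1 := by
  have hterm : ∀ x : EuclideanSpace ℝ (Fin 3),
      ENNReal.ofReal (∑' m : Fin 3 → ℤ, heatKernel t (x - latticeVec L m)) =
        ∑' m : Fin 3 → ℤ, ENNReal.ofReal (heatKernel t (x - latticeVec L m)) := fun x =>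
    ENNReal.ofReal_tsum_of_nonneg (fun m => (heatKernel_pos ht _).le)
      (summable_heatKernel_sub_latticeVec hL ht x)
  have hmeas : ∀ m : Fin 3 → ℤ, AEMeasurable
      (fun x : EuclideanSpace ℝ (Fin 3) => ENNReal.ofReal (heatKernel t (x - latticeVec L m)))
      (volume.restrict (cell L)) := by
    intro m
    refine (ENNReal.measurable_ofReal.comp ?_).aemeasurable
    unfold heatKernel
    fun_prop
  simp_rw [hterm]
  rw [lintegral_tsum hmeas, tsum_lintegral_cell_sub_latticeVec hL fun u => ENNReal.ofReal (heatKernel t u)]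
  have h1 : ∫⁻ u : EuclideanSpace ℝ (Fin 3), ENNReal.ofReal (heatKernel t u) =
      ∫⁻ u : EuclideanSpace ℝ (Fin 3), ‖heatKernel t u‖ₑ := by
    refine lintegral_congr fun u => ?_
    rw [Real.enorm_eq_ofReal (heatKernel_pos ht u).le]
  rw [h1, lintegral_enorm_heatKernel ht]

/-- The periodised heat kernel `x ↦ Σ_m G_t(x - Lm) = Θ_{L,t}(x) + L⁻³` is continuous. [folklore] -/
theorem continuous_tsum_heatKernel_sub_latticeVec {L t : ℝ} (hL : 0 < L) (ht : 0 < t) :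
    Continuous fun x : EuclideanSpace ℝ (Fin 3) => ∑' m : Fin 3 → ℤ, heatKernel t (x - latticeVec L m) := by
  have h : (fun x : EuclideanSpace ℝ (Fin 3) => ∑' m : Fin 3 → ℤ, heatKernel t (x - latticeVec L m)) =
      fun x => periodicHeatSum L t x + 1 / L ^ 3 := by
    funext x
    rw [periodicHeatSum, sub_add_cancel]
  rw [h]
  exact (continuous_periodicHeatSum hL ht).add continuous_const

/-- The periodised heat kernel is integrable on the cell (continuous and bounded by
`Θ_{L,t}(0) + L⁻³` on a set of finite measure). [folklore] -/
theorem integrableOn_cell_tsum_heatKernel {L t : ℝ} (hL : 0 < L) (ht : 0 < t) :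
    IntegrableOn (fun x : EuclideanSpace ℝ (Fin 3) => ∑' m : Fin 3 → ℤ, heatKernel t (x - latticeVec L m))
      (cell L) := by
  have hvol : volume (cell L) < ∞ := by
    rw [volume_cell]
    exact ENNReal.pow_lt_top ENNReal.ofReal_lt_top
  refine Measure.integrableOn_of_bounded (M := periodicHeatSum L t 0 + 1 / L ^ 3) hvol.ne
    (continuous_tsum_heatKernel_sub_latticeVec hL ht).aestronglyMeasurable ?_
  refine (ae_restrict_iff' (measurableSet_cell L)).2 (Eventually.of_forall fun x _ => ?_)
  have h1 : ∑' m : Fin 3 → ℤ, heatKernel t (x - latticeVec L m) = periodicHeatSum L t x + 1 / L ^ 3 := by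
    rw [periodicHeatSum, sub_add_cancel]
  rw [h1, Real.norm_eq_abs]
  calc |periodicHeatSum L t x + 1 / L ^ 3| ≤ |periodicHeatSum L t x| + |1 / L ^ 3| := abs_add_le _ _
    _ ≤ periodicHeatSum L t 0 + 1 / L ^ 3 := by
        rw [abs_of_pos (by positivity : (0 : ℝ) < 1 / L ^ 3)]
        exact add_le_add (abs_periodicHeatSum_le hL ht x) le_rfl

/-- **The cell average of the periodised heat kernel is `L⁻³`**:
`∫_{[0,L)³} Σ_{m ∈ ℤ³} G_t(x - Lm) dx = 1` (`L, t > 0`). [folklore] -/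
theorem integral_cell_tsum_heatKernel {L t : ℝ} (hL : 0 < L) (ht : 0 < t) :
    ∫ x in cell L, (∑' m : Fin 3 → ℤ, heatKernel t (x - latticeVec L m)) = 1 := by
  rw [integral_eq_lintegral_of_nonneg_ae]
  · rw [lintegral_cell_tsum_heatKernel hL ht, ENNReal.toReal_one]
  · exact Eventually.of_forall fun x => tsum_nonneg fun m => (heatKernel_pos ht _).le
  · exact (continuous_tsum_heatKernel_sub_latticeVec hL ht).aestronglyMeasurable

/-- **`Θ_{L,t}` has zero cell mean**: `∫_{[0,L)³} Θ_{L,t}(x) dx = 0` (`L, t > 0`). [folklore] -/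
theorem integral_cell_periodicHeatSum {L t : ℝ} (hL : 0 < L) (ht : 0 < t) :
    ∫ x in cell L, periodicHeatSum L t x = 0 := by
  have hvol : volume.real (cell L) = L ^ 3 := by
    rw [measureReal_def, volume_cell, ENNReal.toReal_pow, ENNReal.toReal_ofReal hL.le]
  have hfin : volume (cell L) ≠ ∞ := by
    rw [volume_cell]
    exact (ENNReal.pow_lt_top ENNReal.ofReal_lt_top).ne
  have hconst : IntegrableOn (fun _ : EuclideanSpace ℝ (Fin 3) => (1 / L ^ 3 : ℝ)) (cell L) :=
    integrableOn_const hfin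
  simp only [periodicHeatSum]
  rw [integral_sub (integrableOn_cell_tsum_heatKernel hL ht) hconst,
    integral_cell_tsum_heatKernel hL ht, setIntegral_const, hvol, smul_eq_mul]
  field_simp
  ring

/-! ## Zero cell mean of the kernel -/

/-- Joint continuity of `(x, t) ↦ Θ_{L,t}(x)` on `ℝ³ × (0, ∞)` (`L > 0`). [folklore] -/
theorem continuousOn_periodicHeatSum_uncurry {L : ℝ} (hL : 0 < L) :
    ContinuousOn (fun z : EuclideanSpace ℝ (Fin 3) × ℝ => periodicHeatSum L z.2 z.1) (univ ×ˢ Ioi 0) := by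
  have hL2 : 0 < L ^ 2 := by positivity
  have h2 : Continuous fun z : EuclideanSpace ℝ (Fin 3) × ℝ =>
      ((z.2 / L ^ 2, Torus.proj (L⁻¹ • z.1)) : ℝ × UnitAddTorus (Fin 3)) :=
    (continuous_snd.div_const (L ^ 2)).prodMk
      (Torus.continuous_proj.comp (continuous_fst.const_smul L⁻¹))
  have hmaps : MapsTo (fun z : EuclideanSpace ℝ (Fin 3) × ℝ =>
      ((z.2 / L ^ 2, Torus.proj (L⁻¹ • z.1)) : ℝ × UnitAddTorus (Fin 3))) (univ ×ˢ Ioi 0)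
      (Ioi 0 ×ˢ univ) :=
    fun z hz => mk_mem_prod (div_pos (mem_prod.1 hz).2 hL2) (mem_univ _)
  have h3 := Torus.continuousOn_heatKernel_uncurry.comp h2.continuousOn hmaps
  have h3' : ContinuousOn (fun z : EuclideanSpace ℝ (Fin 3) × ℝ =>
      Torus.heatKernel (z.2 / L ^ 2) (Torus.proj (L⁻¹ • z.1))) (univ ×ˢ Ioi 0) := by
    refine h3.congr fun z _ => ?_
    simp only [Function.comp_apply]
  have h1 : ContinuousOn (fun z : EuclideanSpace ℝ (Fin 3) × ℝ =>
      (L ^ 3)⁻¹ * (Torus.heatKernel (z.2 / L ^ 2) (Torus.proj (L⁻¹ • z.1)) - 1)) (univ ×ˢ Ioi 0) :=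
    continuousOn_const.mul (h3'.sub continuousOn_const)
  exact h1.congr fun z hz => periodicHeatSum_eq hL (mem_prod.1 hz).2 z.1

/-- The subordination integrand `(x, t) ↦ t^a Θ_{L,t}(x)` is integrable on `[0,L)³ × (η², ∞)`
(`L > 0`, `η ≠ 0`): jointly continuous and dominated by `D t^a e^{-4π²t/L²}`. [folklore] -/
theorem integrable_rpow_mul_periodicHeatSum_prod {L η : ℝ} (hL : 0 < L) (hη : η ≠ 0) (a : ℝ) :
    Integrable (uncurry fun (x : EuclideanSpace ℝ (Fin 3)) (t : ℝ) => t ^ a * periodicHeatSum L t x)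
      ((volume.restrict (cell L)).prod (volume.restrict (Ioi (η ^ 2)))) := by
  have hη2 : 0 < η ^ 2 := by positivity
  obtain ⟨D, -, hD⟩ := exists_abs_periodicHeatSum_le_mul_exp hL hη2
  haveI : IsFiniteMeasure (volume.restrict (cell L)) := by
    refine ⟨?_⟩
    rw [Measure.restrict_apply_univ, volume_cell]
    exact ENNReal.pow_lt_top ENNReal.ofReal_lt_top
  -- measurability from joint continuity
  have hmeas : AEStronglyMeasurable
      (uncurry fun (x : EuclideanSpace ℝ (Fin 3)) (t : ℝ) => t ^ a * periodicHeatSum L t x)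
      ((volume.restrict (cell L)).prod (volume.restrict (Ioi (η ^ 2)))) := by
    rw [Measure.prod_restrict]
    refine ContinuousOn.aestronglyMeasurable ?_ ((measurableSet_cell L).prod measurableSet_Ioi)
    have hcont : ContinuousOn (fun z : EuclideanSpace ℝ (Fin 3) × ℝ => z.2 ^ a * periodicHeatSum L z.2 z.1)
        (univ ×ˢ Ioi 0) := by
      refine ContinuousOn.mul (fun z hz => ?_) (continuousOn_periodicHeatSum_uncurry hL)
      exact ((Real.continuousAt_rpow_const z.2 a (Or.inl (ne_of_gt (mem_prod.1 hz).2))).comp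
        continuousAt_snd).continuousWithinAt
    exact hcont.mono (prod_mono (subset_univ _) (Ioi_subset_Ioi hη2.le))
  -- domination by an integrable product function
  refine Integrable.mono' ((integrable_const (1 : ℝ)).mul_prod
    ((integrableOn_rpow_mul_exp_neg (a := a) (c := 4 * π ^ 2 / L ^ 2) (by positivity) hη2).const_mul D))
    hmeas ?_
  rw [Measure.prod_restrict]
  refine (ae_restrict_iff' ((measurableSet_cell L).prod measurableSet_Ioi)).2
    (Eventually.of_forall fun z hz => ?_)
  obtain ⟨x, t⟩ := z
  have ht : η ^ 2 < t := (mem_prod.1 hz).2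
  have ht0 : 0 < t := hη2.trans ht
  simp only [uncurry_apply_pair, one_mul]
  rw [norm_mul, Real.norm_of_nonneg (Real.rpow_nonneg ht0.le a), Real.norm_eq_abs]
  calc t ^ a * |periodicHeatSum L t x| ≤ t ^ a * (D * Real.exp (-(4 * π ^ 2 / L ^ 2) * t)) :=
        mul_le_mul_of_nonneg_left (hD t ht.le x) (Real.rpow_nonneg ht0.le a)
    _ = D * (t ^ a * Real.exp (-(4 * π ^ 2 / L ^ 2) * t)) := by ring

/-- **The periodic Riesz kernel has zero cell mean**: `∫_{[0,L)³} g(x) dx = 0` for `L > 0`,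
`η ≠ 0` and every real `s` — the zero Fourier mode `ĝ(0)` vanishes (neutralising background;
Lewin 2022, Serfaty 2024 Ch. 3–4). Fubini over `[0,L)³ × (η², ∞)` and
`integral_cell_periodicHeatSum`. [folklore] -/
theorem integral_cell_periodicRieszKernel (s : ℝ) {L η : ℝ} (hL : 0 < L) (hη : η ≠ 0) :
    ∫ x in cell L, periodicRieszKernel s L η x = 0 := by
  have hη2 : 0 < η ^ 2 := by positivity
  simp only [periodicRieszKernel]
  rw [integral_const_mul]
  refine mul_eq_zero_of_right _ ?_
  rw [integral_integral_swap (integrable_rpow_mul_periodicHeatSum_prod hL hη _)]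
  refine setIntegral_eq_zero_of_forall_eq_zero fun t ht => ?_
  rw [integral_const_mul, integral_cell_periodicHeatSum hL (hη2.trans ht), mul_zero]

end Literature.MathematicalPhysics.StatisticalMechanics

end
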